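import Literature.Topology.FourManifolds.SurfaceGenusParityProofs
import Literature.Topology.FourManifolds.InteriorConnected
import Literature.Topology.FourManifolds.DehnSurgeryHomology
import Literature.Topology.FourManifolds.SliceDiscZeroFraming
import HarnessLib

/-!
# The Seifert longitude is null-homologous: Seifert tubes have framing zero

Topic `Literature/Topology/FourManifolds`; fact seat
`provefact-Literature.Topology.FourManifolds.isUnknot_of_isIntegralSurgery_zero` (Property R,
D. Gabai, *Foliations and the topology of 3-manifolds. III*, J. Differential Geom. 26 (1987),
Cor. 8.3 and Remark 8.5). A **proved** brick of the printed line, second after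
`DehnSurgeryHomology.lean` (Def. 8.1: zero frame surgery is a homology `S² × S¹`): Gabai's
Definition 8.1 — *"A longitude of `k` is the unique (up to isotopy) essential simple closed
curve `λ` in `∂N(k)` such that `0 = [λ] ∈ H₁(N - N̊(k))`. The manifold `M` is obtained by zero
frame surgery on `k` if it is obtained by performing Dehn surgery to the longitude"* — met by the
curve along which a Seifert surface `S` of `k` leaves a tubular neighbourhood of `k` (Cor. 8.2:
*"`Ŝ - N̊(k) = S`"*): **the push-off of the knot into a Seifert surface is null-homologous in the
knot complement, so a tubular neighbourhood adapted to a Seifert surface has framing `0`** (the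
*Seifert framing* is the `0`-framing: Juhász, *Differential and Low-Dimensional Topology* (2023),
Remark 4.12; the *preferred longitude*: Cromwell, *Knots and Links* (2004), §4.2 and Thm. 5.8.1,
proof, Step 5 — a loop on `∂V` bounding a surface outside `V` has linking number `0` with the
core). This is the input that lets a Seifert surface be put in normal position with respect to
the `0`-framed tube of a zero frame surgery (uniqueness of `0`-framed tubes,
`Knot.TubularNbhd.exists_diffeomorph_eq_of_hasFraming`), i.e. the capping `Ŝ` of Cor. 8.2/8.3.

## The argument

The knot-theoretic statement reduces at once to a statement about the abstract surface: if
`G : S ∖ ∂S → S³ ∖ K` is *any* continuous map of the interior of a compact connected orientable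
surface `S` with one boundary circle into a knot complement, then the image of a *collar loop*
(the boundary circle pushed to a positive collar height) has Hurewicz class `0` in
`H₁(S³ ∖ K; ℤ)`, because that class is **torsion already in `H₁(S ∖ ∂S; ℤ)`** and
`H₁(S³ ∖ K; ℤ) ≅ ℤ·h(μ)` is torsion free (the meridian has infinite order,
`Knot.TubularNbhd.zsmul_loopClass_meridian_injective`; it generates,
`Knot.TubularNbhd.exists_eq_zsmul_loopClass_meridian` — `DehnSurgeryHomology.lean`, from the
tree's `H₁(S³ ∖ K) ≅ ℤ`, Crowell–Fox VIII (1.2), through the Hurewicz homomorphism of Hatcher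
Thm. 2A.1).

The surface statement (`CapData.exists_ne_zero_and_smul_loopClass_collarLoop_eq_zero`) is proved
on the **capped surface** `P = S ∪_φ 𝔻²` of the tree (`CapData.P`, `SurfaceCapping.lean`; Hirsch,
*Differential Topology* Ch. 9 §3; Massey Ch. I §10) by Mayer–Vietoris (Hatcher §2.2, exactness
proved in the tree) for the open cover `P = A ∪ B`, `A = jS(S ∖ ∂S)` (the open surface),
`B = 𝔻̊² ∪ seam (∂S × [0, 1))` (the open disc enlarged by the collar), `A ∩ B ≃ ∂S ≅ 𝕊¹`:

  `0 = H₂(A) ⊕ H₂(B) → H₂(P) → H₁(A ∩ B) → H₁(A) ⊕ H₁(B) → H₁(P)`.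

Here `H₂(A) = 0` (`A` is a connected non-compact surface, Hatcher Prop. 3.29), `Hₙ(B) = 0` for
`n ≠ 0` (`B ≃ jD(𝔻²) ≅ 𝔻²` by the collar pushes of a topological boundary collar of
`W_B = 𝔻̊² ∪ seam (∂S × [0, 1])`, `Literature.AlgebraicTopology.Homotopy.BoundaryCollar`, Hatcher
Prop. 3.42), `H₂(P) ≅ ℤ` (**this is where orientability enters**: `P` is a closed connected
orientable surface, `CapData.isOrientable_P`, hence `ℤ`-oriented, Bredon VI.7.15, and Hatcher
Thm. 3.26 applies — `CapData.finrank_singularHomology_P_two`) and `H₁(A ∩ B) ≅ H₁(𝕊¹) ≅ ℤ`.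
Counting ranks, the image of `H₁(A ∩ B)` in `H₁(A) ⊕ H₁(B)` — the kernel of
`H₁(A) ⊕ H₁(B) → H₁(P)` — has rank `1 - 1 = 0`, so it is torsion
(`exists_smul_eq_zero_of_exact_of_finrank_eq`, `CapData.exists_smul_eq_zero_of_map_aSet_eq_zero`).
Finally a collar loop of height `s ∈ (0, 1)` lies in `B`, so its class dies in `H₁(P)`, hence is
torsion in `H₁(A) ≅ H₁(S ∖ ∂S)`. (For the Möbius band, `P = ℝP²`, `H₂(P) = 0`, and indeed the
boundary circle is twice the core: orientability is essential.)

## Main results (all proved; no named facts, no new definitions beyond auxiliary sets/loops)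

* `CapData.exists_smul_eq_zero_of_map_aSet_eq_zero` — the kernel of
  `H₁(S ∖ ∂S; ℤ) → H₁(S ∪_φ 𝔻²; ℤ)` is torsion;
* `CapData.exists_ne_zero_and_smul_loopClass_collarLoop_eq_zero` — collar loops are torsion in
  `H₁(S ∖ ∂S; ℤ)`;
* `Knot.loopClass_collarLoop_map_eq_zero` — **the Seifert longitude is null-homologous**: under any
  continuous `G : S ∖ ∂S → S³ ∖ K`, collar loops have Hurewicz class `0` in `H₁(S³ ∖ K; ℤ)`
  (Gabai Def. 8.1; Cromwell Thm. 5.8.1 Step 5);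
* `Knot.TubularNbhd.hasFraming_zero_of_loopClass_longitude_eq_zero` — a tube whose longitude is
  null-homologous has framing `0` (Cromwell §4.2, "preferred longitude");
* `Knot.TubularNbhd.hasFraming_zero_of_longitude_eq_collarLoop` — **Seifert tubes have framing
  zero** (Juhász 2023, Remark 4.12): if the longitude of `ν` is pointwise a collar loop of such a
  surface mapped into `S³ ∖ K`, then `ν.HasFraming 0`.

## References

* D. Gabai, *Foliations and the topology of 3-manifolds. III*, J. Differential Geom. 26 (1987)
  479–536, Def. 8.1 (p. 524), Cor. 8.2 (pp. 524–525). [GabaiJDG1987]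
* A. Juhász, *Differential and Low-Dimensional Topology*, LMS Student Texts 104 (2023),
  Remark 4.12 (the Seifert framing). [Juhasz2023]
* P. Cromwell, *Knots and Links* (2004), §4.2 (preferred longitude), Thm. 5.8.1, proof, Step 5.
  [Cromwell2004]
* A. Hatcher, *Algebraic Topology* (2002), §2.2 (Mayer–Vietoris), Thm. 2A.1, Thm. 2.44 (rank
  count), Prop. 3.29, Thm. 3.26, Prop. 3.42. [HatcherAT2002]
* D. Rolfsen, *Knots and Links* (1976), §5.D (`H₁` of knot complements, longitudes). [Rolfsen1976]

## Design notes

* The surface enters the knot statements only through `c : CapData S` (boundary circle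
  diffeomorphisms and long open collars; non-vacuous by `CapData.nonempty` for a compact
  orientable `S` with `∂S ≃ₜ 𝕊¹`) and a continuous map of the *interior*
  `InteriorManifold (𝓡∂ 2) S` into `K.complement`: for a Seifert surface `F` (`F|∂S = K ∘ e`,
  `F` injective) the interior is exactly what `F` maps into the complement. The consumer (normal
  position of Seifert surfaces) chooses the capping data first and adapts the tube to its collar
  `c.CS`, so the longitude is literally a collar loop.
* Collar heights are those of the long open collar `c.CS` (`∂S × [0, ∞) → S`); the loops are taken
  at heights `s ∈ (0, 1)`, inside the seam chart of `P`.
* Mayer–Vietoris pieces are `Set c.P`s so that `…SingularHomology.ExcisionMayerVietoris` applies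
  verbatim, following `SurfaceGenusParityProofs.lean` (whose cover `uSet ∪ discSet` thickens `S`
  into the disc; here the disc is thickened into `S` instead, so that the surface piece is the
  interior of `S`, which maps to the knot complement).
* No `sorry`, no new instances; local notations `𝔼 n`, `𝕊 n`, `𝔻 n` as in the sibling files.
-/

noncomputable section

open Set Function CategoryTheory Limits
open scoped Manifold ContDiff Topology unitInterval ContinuousMap
open Literature.AlgebraicTopology.SingularHomology Literature.AlgebraicTopology.Homotopy

namespace Literature.Topology.FourManifolds

/-- Local notation: `𝔼 n` is the model Euclidean space `EuclideanSpace ℝ (Fin n)`. -/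
local notation "𝔼 " n:arg => EuclideanSpace ℝ (Fin n)

/-- Local notation: `𝕊 n` is the unit sphere in `EuclideanSpace ℝ (Fin (n + 1))`. -/
local notation "𝕊 " n:arg => (Metric.sphere (0 : EuclideanSpace ℝ (Fin (n + 1))) 1)

/-- Local notation: `𝔻 n` is the closed unit ball in `EuclideanSpace ℝ (Fin n)`. -/
local notation "𝔻 " n:arg => (Metric.closedBall (0 : EuclideanSpace ℝ (Fin n)) 1)

/-! ### Algebra: the image of a map out of a rank-exhausted module is torsion -/

section Algebra

variable {R : Type*} [CommRing R] {A B C : ModuleCat.{0} R}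

/-- Along an exact `A →f B →g C` with `f` mono, `B` finitely generated over a domain and
`rank A = rank B`, the image of `g` is a torsion module: every `y ∈ im g` is killed by a non-zero
scalar (rank–nullity: `rank (im g) = rank B - rank A = 0`). [folklore] -/
theorem exists_smul_eq_zero_of_exact_of_finrank_eq [IsDomain R] {f : A ⟶ B} {g : B ⟶ C} [Mono f]
    [Module.Finite R B] (w : f ≫ g = 0) (h : (ShortComplex.mk f g w).Exact)
    (hAB : Module.finrank R A = Module.finrank R B) {y : C} (hy : y ∈ LinearMap.range g.hom) :
    ∃ r : R, r ≠ 0 ∧ r • y = 0 := by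
  have hr : Module.finrank R (LinearMap.range g.hom) = 0 := by
    have := finrank_eq_of_exact_of_mono w h
    omega
  haveI : Module.Finite R (LinearMap.range g.hom) := Module.Finite.range g.hom
  obtain ⟨r, hr0, hry⟩ := Module.finrank_eq_zero_iff.1 hr ⟨y, hy⟩
  exact ⟨r, hr0, by simpa using congrArg Subtype.val hry⟩

end Algebra

/-! ### The cover of the capped surface by the open surface and the big open disc -/

section Cap

variable {S : Type} [TopologicalSpace S] [ChartedSpace (EuclideanHalfSpace 2) S]
  [IsManifold (𝓡∂ 2) ∞ S]

variable (c : CapData S) [Nonempty ((𝓡∂ 2).boundary S)]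

namespace CapData

/-- **The open surface piece** `A = inl (inr (S ∖ ∂S)) ⊆ P`: the image of the interior of `S` in
the capped surface. [folklore] -/
def aSet : Set c.P := range fun x : InteriorManifold (𝓡∂ 2) S => c.G.d₂.inl (c.G.d₁.inr x)

/-- **The big open disc** `B = V ∪ seam (∂S × (-∞, 1)) ⊆ P`: the open disc thickened by the open
seam collar of height `< 1` into `S`. [folklore] -/
def bSet : Set c.P := c.discSet ∪ c.seam '' {p | p.2 < 1}

/-- **The closed thickening** `W_B = V ∪ seam (∂S × (-∞, 1]) ⊆ P` of the big open disc, on which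
`(z, s) ↦ seam (z, 1 - s)` is a topological boundary collar. [folklore] -/
def wbSet : Set c.P := c.discSet ∪ c.seam '' {p | p.2 ≤ 1}

/-- `A` is open. [folklore] -/
theorem isOpen_aSet : IsOpen c.aSet :=
  (c.G.d₂.isOpenMap_inl.comp c.G.d₁.isOpenMap_inr).isOpen_range

/-- `B` is open. [folklore] -/
theorem isOpen_bSet : IsOpen c.bSet :=
  c.isOpen_discSet.union (c.isOpenMap_seam _ (isOpen_lt continuous_snd continuous_const))

/-- A seam point lies in `A` iff its height is `> 0`. [folklore] -/
theorem seam_mem_aSet_iff {p : ↥((𝓡∂ 2).boundary S) × ℝ} : c.seam p ∈ c.aSet ↔ 0 < p.2 := by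
  constructor
  · rintro ⟨x, hx⟩
    have h' : p ∈ c.G.d₁.glue.source :=
      (c.G.d₁.inl_eq_inr_iff.1 (c.G.d₂.inl_injective hx).symm).1
    exact h'
  · intro hp
    refine ⟨⟨c.CS.toFun p.1 p.2, c.CS.isInteriorPoint_apply p.1 hp⟩, ?_⟩
    show c.G.d₂.inl (c.G.d₁.inr _) = c.G.d₂.inl (c.G.d₁.inl p)
    rw [← c.G.jM_of_isInteriorPoint (c.CS.isInteriorPoint_apply p.1 hp)]
    exact c.G.jM_toFun p.1 hp.le

/-- A seam point of negative height lies in the open disc (restated). [folklore] -/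
theorem seam_mem_discSet_iff {p : ↥((𝓡∂ 2).boundary S) × ℝ} : c.seam p ∈ c.discSet ↔ p.2 < 0 :=
  c.seam_mem_range_inr_iff

/-- A seam point lies in `B` iff its height is `< 1`. [folklore] -/
theorem seam_mem_bSet_iff {p : ↥((𝓡∂ 2).boundary S) × ℝ} : c.seam p ∈ c.bSet ↔ p.2 < 1 := by
  constructor
  · rintro (h | ⟨q, hq, hqp⟩)
    · have := c.seam_mem_discSet_iff.1 h
      linarith
    · obtain rfl : q = p := c.seam_injective hqp
      exact hq
  · exact fun hp => Or.inr ⟨p, hp, rfl⟩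

/-- A seam point lies in `W_B` iff its height is `≤ 1`. [folklore] -/
theorem seam_mem_wbSet_iff {p : ↥((𝓡∂ 2).boundary S) × ℝ} : c.seam p ∈ c.wbSet ↔ p.2 ≤ 1 := by
  constructor
  · rintro (h | ⟨q, hq, hqp⟩)
    · have := c.seam_mem_discSet_iff.1 h
      linarith
    · obtain rfl : q = p := c.seam_injective hqp
      exact hq
  · exact fun hp => Or.inr ⟨p, hp, rfl⟩

/-- A point of `A` is not in the open disc. [folklore] -/
theorem not_mem_discSet_of_mem_aSet {x : c.P} (hx : x ∈ c.aSet) : x ∉ c.discSet := by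
  obtain ⟨y, rfl⟩ := hx
  exact c.inl_inr_not_mem_range_inr y

/-- `B ⊆ W_B`. [folklore] -/
theorem bSet_subset_wbSet : c.bSet ⊆ c.wbSet :=
  union_subset_union_right _ (image_mono fun p (hp : p.2 < 1) => (le_of_lt hp : p.2 ≤ 1))

/-- **`A ∩ B` is the open seam collar `seam (∂S × (0, 1))`.** [folklore] -/
theorem aSet_inter_bSet : c.aSet ∩ c.bSet = c.seam '' {p | 0 < p.2 ∧ p.2 < 1} := by
  ext x
  constructor
  · rintro ⟨ha, hb⟩
    rcases hb with h | ⟨p, hp, rfl⟩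
    · exact absurd h (c.not_mem_discSet_of_mem_aSet ha)
    · exact ⟨p, ⟨c.seam_mem_aSet_iff.1 ha, hp⟩, rfl⟩
  · rintro ⟨p, ⟨h1, h2⟩, rfl⟩
    exact ⟨c.seam_mem_aSet_iff.2 h1, c.seam_mem_bSet_iff.2 h2⟩

/-- **`A` and `B` cover `P`.** [folklore] -/
theorem aSet_union_bSet : c.aSet ∪ c.bSet = univ := by
  refine eq_univ_of_forall fun q => ?_
  obtain (⟨x, rfl⟩ | ⟨y, rfl⟩) := c.G.d₂.exists_inl_or_inr q
  · obtain (⟨p, rfl⟩ | ⟨a, rfl⟩) := c.G.d₁.exists_inl_or_inr x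
    · rcases lt_or_ge p.2 1 with h | h
      · exact Or.inr (c.seam_mem_bSet_iff.2 h)
      · exact Or.inl (c.seam_mem_aSet_iff.2 (by linarith))
    · exact Or.inl ⟨a, rfl⟩
  · exact Or.inr (Or.inl ⟨y, rfl⟩)

/-- The interiors of `A` and `B` cover `P` (both are open). [folklore] -/
theorem interior_aSet_union_interior_bSet : interior c.aSet ∪ interior c.bSet = univ := by
  rw [c.isOpen_aSet.interior_eq, c.isOpen_bSet.interior_eq, c.aSet_union_bSet]

/-- `A ∩ B` is path connected (the image of `∂S × (0, 1)`, `∂S ≅ 𝕊¹`). [folklore] -/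
theorem isPathConnected_aSet_inter_bSet : IsPathConnected (c.aSet ∩ c.bSet) := by
  rw [c.aSet_inter_bSet]
  have hsph := isPathConnected_sphere (E := 𝔼 2) (by
    rw [← Module.finrank_eq_rank, finrank_euclideanSpace_fin]; norm_num) (0 : 𝔼 2) zero_le_one
  have h𝕊 : IsPathConnected (univ : Set ↥(𝕊 1)) :=
    pathConnectedSpace_iff_univ.1 (isPathConnected_iff_pathConnectedSpace.1 hsph)
  have hA : IsPathConnected (univ : Set ↥((𝓡∂ 2).boundary S)) := by
    have := h𝕊.image c.φS.toHomeomorph.symm.continuous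
    rwa [image_univ_of_surjective c.φS.toHomeomorph.symm.surjective] at this
  have hset : {p : ↥((𝓡∂ 2).boundary S) × ℝ | 0 < p.2 ∧ p.2 < 1} = univ ×ˢ Ioo 0 1 := by
    ext p
    exact ⟨fun h => ⟨trivial, h⟩, fun h => h.2⟩
  rw [hset]
  exact (hA.prod ((convex_Ioo (0 : ℝ) 1).isPathConnected
    ⟨2⁻¹, by norm_num, by norm_num⟩)).image c.continuous_seam

/-! #### The open surface piece `A ≅ S ∖ ∂S` -/

/-- The map `S ∖ ∂S → A`, `x ↦ inl (inr x)`, is an open embedding into `P`. [folklore] -/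
theorem isOpenEmbedding_inl_inr :
    _root_.Topology.IsOpenEmbedding fun x : InteriorManifold (𝓡∂ 2) S => c.G.d₂.inl (c.G.d₁.inr x) :=
  (c.G.d₂.isOpenEmbedding_inl).comp c.G.d₁.isOpenEmbedding_inr

/-- **`A` is homeomorphic to the interior `S ∖ ∂S`.** [folklore] -/
def aSetHomeomorph : InteriorManifold (𝓡∂ 2) S ≃ₜ ↥c.aSet :=
  c.isOpenEmbedding_inl_inr.isEmbedding.toHomeomorph

/-- The underlying point of `aSetHomeomorph x` is `inl (inr x)`. [folklore] -/
@[simp] theorem coe_aSetHomeomorph (x : InteriorManifold (𝓡∂ 2) S) :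
    (c.aSetHomeomorph x : c.P) = c.G.d₂.inl (c.G.d₁.inr x) := rfl

/-- A collar point of positive height, as a point of the interior `S ∖ ∂S`. [folklore] -/
def collarPt' (z : (𝓡∂ 2).boundary S) {s : ℝ} (hs : 0 < s) : InteriorManifold (𝓡∂ 2) S :=
  ⟨c.CS.toFun z s, c.CS.isInteriorPoint_apply z hs⟩

/-- The image in `P` of a collar point of positive height is the seam point. [folklore] -/
theorem inl_inr_collarPt' (z : (𝓡∂ 2).boundary S) {s : ℝ} (hs : 0 < s) :
    c.G.d₂.inl (c.G.d₁.inr (c.collarPt' z hs)) = c.seam (z, s) := by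
  rw [c.inl_inr_eq_jS]
  exact c.G.jM_toFun z hs.le

/-- `A` is connected (`S` connected): it is homeomorphic to the interior of `S`, which is connected
(`InteriorManifold.instConnectedSpace`). [folklore] -/
theorem connectedSpace_aSet [ConnectedSpace S] : ConnectedSpace ↥c.aSet :=
  c.aSetHomeomorph.surjective.connectedSpace c.aSetHomeomorph.continuous

omit [Nonempty ((𝓡∂ 2).boundary S)] in
/-- **`A` is not compact** (`S` connected): it is a proper non-empty open subset of the connected
Hausdorff surface `P` (the seam circle `seam (∂S × {0})` is missing). [folklore] -/
theorem noncompactSpace_aSet [T2Space S] [ConnectedSpace S] [Nonempty ((𝓡∂ 2).boundary S)] :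
    NoncompactSpace ↥c.aSet := by
  haveI := c.connectedSpace_P
  rw [← not_compactSpace_iff]
  intro hc
  have hK : IsCompact c.aSet := isCompact_iff_compactSpace.2 hc
  obtain ⟨z⟩ := (inferInstance : Nonempty ((𝓡∂ 2).boundary S))
  rcases isClopen_iff.1 ⟨hK.isClosed, c.isOpen_aSet⟩ with h | h
  · have hz : c.seam (z, 1) ∈ c.aSet := c.seam_mem_aSet_iff.2 one_pos
    rw [h] at hz
    exact hz
  · have hz : c.seam (z, 0) ∈ c.aSet := by
      rw [h]
      exact mem_univ _
    exact lt_irrefl _ (c.seam_mem_aSet_iff.1 hz)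

/-- **`H₂(A; ℤ) = 0`** (`S` connected): `A` is a connected non-compact surface (an open subset of
`P`), Hatcher 2002, Prop. 3.29 (`isZero_singularHomology_of_noncompactSpace_holds`).
[cite: HatcherAT2002, Prop. 3.29] -/
theorem isZero_singularHomology_aSet_two [T2Space S] [ConnectedSpace S] :
    IsZero (singularHomology ℤ ℤ ↥c.aSet 2) := by
  haveI : ChartedSpace (𝔼 2) ↥c.aSet :=
    inferInstanceAs (ChartedSpace (𝔼 2) ↥(⟨c.aSet, c.isOpen_aSet⟩ : TopologicalSpace.Opens c.P))
  haveI : ConnectedSpace ↥c.aSet := c.connectedSpace_aSet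
  haveI := c.noncompactSpace_aSet
  exact isZero_singularHomology_of_noncompactSpace_holds ℤ (↥c.aSet) 2 le_rfl

/-! #### The big disc: `range jD = V ∪ seam (∂S × (-∞, 0])` and the collar of `W_B` -/

omit [Nonempty ((𝓡∂ 2).boundary S)] in
/-- **The closed disc piece** `jD(𝔻²) = V ∪ seam (∂S × (-∞, 0])`. [folklore] -/
theorem range_jD_eq [Nonempty ((𝓡∂ 2).boundary S)] :
    range c.jD = c.discSet ∪ c.seam '' {p | p.2 ≤ 0} := by
  refine Subset.antisymm ?_ ?_
  · rintro _ ⟨y, rfl⟩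
    rcases BoundaryGlueData.exists_incl_or_isInteriorPoint
        (bM := BoundaryManifold.boundaryData 1 (𝔻 2)) y with ⟨w, rfl⟩ | hy
    · refine Or.inr ⟨(c.φ.symm w, 0), (show (0 : ℝ) ≤ 0 from le_rfl), ?_⟩
      exact (c.G.jN_incl w).symm
    · exact Or.inl ⟨⟨y, hy⟩, (c.G.jN_of_isInteriorPoint hy).symm⟩
  · rintro x (⟨y, rfl⟩ | ⟨p, hp, rfl⟩)
    · exact ⟨y.val, c.G.jN_of_isInteriorPoint y.property⟩
    · have hp' : 0 ≤ -p.2 := by simpa using (hp : p.2 ≤ 0)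
      refine ⟨c.CD.toFun (c.φ p.1) (-p.2), ?_⟩
      have h := c.G.jN_toFun p.1 hp'
      rw [neg_neg] at h
      exact h

/-- The points of `W_B`: a point of the open disc, or a seam point of height in `[0, 1]`. [folklore] -/
theorem wbSet_cases {x : c.P} (hx : x ∈ c.wbSet) :
    x ∈ c.discSet ∨ ∃ p : ↥((𝓡∂ 2).boundary S) × ℝ, (0 ≤ p.2 ∧ p.2 ≤ 1) ∧ c.seam p = x := by
  rcases hx with h | ⟨p, hp, rfl⟩
  · exact Or.inl h
  · rcases lt_or_ge p.2 0 with h0 | h0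
    · exact Or.inl (c.seam_mem_discSet_iff.2 h0)
    · exact Or.inr ⟨p, ⟨h0, hp⟩, rfl⟩

/-- `jD(𝔻²) ⊆ W_B`. [folklore] -/
theorem range_jD_subset_wbSet : range c.jD ⊆ c.wbSet := by
  rw [c.range_jD_eq]
  exact union_subset_union_right _ (image_mono fun p (hp : p.2 ≤ 0) => (by
    show p.2 ≤ 1
    linarith))

/-- The collar point `seam (z, 1 - s) ∈ W_B` of level `s ∈ [0, 1]` (the collar of `W_B` runs from
its frontier circle `seam (∂S × {1})` down to the seam `seam (∂S × {0})`). [folklore] -/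
def collarPtB (q : ↥((𝓡∂ 2).boundary S) × I) : ↥c.wbSet :=
  ⟨c.seam (q.1, 1 - (q.2 : ℝ)),
    Or.inr ⟨(q.1, 1 - (q.2 : ℝ)), (by
      show 1 - (q.2 : ℝ) ≤ 1
      linarith [unitInterval.nonneg q.2]), rfl⟩⟩

/-- The underlying point of `collarPtB`. [folklore] -/
@[simp] theorem coe_collarPtB (q : ↥((𝓡∂ 2).boundary S) × I) :
    (c.collarPtB q : c.P) = c.seam (q.1, 1 - (q.2 : ℝ)) := rfl

/-- `collarPtB` is continuous. [folklore] -/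
theorem continuous_collarPtB : Continuous c.collarPtB :=
  (c.continuous_seam.comp (continuous_fst.prodMk
    (continuous_const.sub (continuous_subtype_val.comp continuous_snd)))).subtype_mk _

/-- `collarPtB` is injective. [folklore] -/
theorem collarPtB_injective : Injective c.collarPtB := by
  intro q q' h
  have h' := c.seam_injective (congrArg Subtype.val h)
  simp only [Prod.mk.injEq] at h'
  exact Prod.ext h'.1 (Subtype.ext (by linarith [h'.2]))

/-- The half-open collar `collarPtB (∂S × [0, 1))` is the trace on `W_B` of the open seam set
`seam (∂S × (0, ∞))`. [folklore] -/
theorem image_collarPtB_lt_one :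
    c.collarPtB '' {q | q.2 < 1} = Subtype.val ⁻¹' (c.seam '' {p | 0 < p.2}) := by
  ext w
  constructor
  · rintro ⟨q, hq, rfl⟩
    have hq' : (q.2 : ℝ) < 1 := hq
    exact ⟨(q.1, 1 - (q.2 : ℝ)), (by show (0 : ℝ) < 1 - q.2; linarith), rfl⟩
  · rintro ⟨p, hp, hpw⟩
    have hp' : 0 < p.2 := hp
    rcases c.wbSet_cases w.2 with hw | ⟨p', ⟨-, h1⟩, hp'w⟩
    · rw [← hpw] at hw
      have := c.seam_mem_discSet_iff.1 hw
      linarith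
    · have hpp : p' = p := c.seam_injective (hp'w.trans hpw.symm)
      subst hpp
      have hlev : (0 : ℝ) ≤ 1 - p'.2 ∧ 1 - p'.2 ≤ 1 := ⟨by linarith, by linarith⟩
      refine ⟨(p'.1, ⟨1 - p'.2, hlev⟩), ?_, ?_⟩
      · show 1 - p'.2 < 1
        linarith
      · apply Subtype.ext
        rw [coe_collarPtB, ← hp'w]
        simp

omit [Nonempty ((𝓡∂ 2).boundary S)] in
/-- The boundary of a compact `C^∞` surface with boundary is compact. [folklore] -/
private theorem compactSpace_boundary_two' [CompactSpace S] : CompactSpace ((𝓡∂ 2).boundary S) :=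
  isCompact_iff_compactSpace.1 (ModelWithCorners.isClosed_boundary (M := S) (n := ∞) (by simp) :
    IsClosed ((𝓡∂ 2).boundary S)).isCompact

variable [T2Space S] [CompactSpace S]

/-- **The reversed seam collar is a topological boundary collar of `W_B`** (`BoundaryCollar`,
`CollarPush.lean`): `(z, s) ↦ seam (z, 1 - s)` is a closed embedding `∂S × [0, 1] → W_B` whose
half-open part `seam (∂S × (0, 1])` is open in `W_B`. [folklore] -/
def capCollarB : BoundaryCollar ↥c.wbSet ↥((𝓡∂ 2).boundary S) where
  collar := c.collarPtB
  isClosedEmbedding_collar := by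
    haveI := compactSpace_boundary_two' (S := S)
    exact c.continuous_collarPtB.isClosedEmbedding c.collarPtB_injective
  isOpen_image := by
    rw [c.image_collarPtB_lt_one]
    exact (c.isOpenMap_seam _ (isOpen_lt continuous_const continuous_snd)).preimage
      continuous_subtype_val

/-- The collar map of `capCollarB` is `collarPtB`. [folklore] -/
@[simp] theorem capCollarB_collar : c.capCollarB.collar = c.collarPtB := rfl

/-- The open collar of `W_B` below level `1` is the trace of `seam (∂S × (0, ∞))`. [folklore] -/
theorem capCollarB_below_one :
    c.capCollarB.below 1 = Subtype.val ⁻¹' (c.seam '' {p | 0 < p.2}) :=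
  c.image_collarPtB_lt_one

/-- **The core of `W_B` at level `1` is the closed disc `jD(𝔻²)`.** [folklore] -/
theorem capCollarB_core_one : c.capCollarB.core 1 = Subtype.val ⁻¹' range c.jD := by
  ext w
  rw [BoundaryCollar.mem_core_iff, capCollarB_below_one, mem_preimage, mem_preimage, c.range_jD_eq]
  constructor
  · intro hw
    rcases c.wbSet_cases w.2 with h | ⟨p, ⟨h0, -⟩, hpw⟩
    · exact Or.inl h
    · rcases h0.lt_or_eq with h0 | h0
      · exact (hw ⟨p, h0, hpw⟩).elim
      · exact Or.inr ⟨p, h0.symm.le, hpw⟩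
  · rintro (hw | ⟨p, hp, hpw⟩) ⟨p', hp', hp'w⟩
    · rw [← hp'w] at hw
      have := c.seam_mem_discSet_iff.1 hw
      have h'' : 0 < p'.2 := hp'
      linarith
    · have hpp : p' = p := c.seam_injective (hp'w.trans hpw.symm)
      subst hpp
      have h1 : p'.2 ≤ 0 := hp
      have h2 : 0 < p'.2 := hp'
      linarith

/-- **The interior of `W_B` (off its frontier circle `seam (∂S × {1})`) is `B`.** [folklore] -/
theorem capCollarB_interior : c.capCollarB.interior = Subtype.val ⁻¹' c.bSet := by
  ext w
  rw [BoundaryCollar.mem_interior_iff, mem_preimage]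
  constructor
  · intro hw
    rcases c.wbSet_cases w.2 with h | ⟨p, ⟨-, h1⟩, hpw⟩
    · exact Or.inl h
    · rcases h1.lt_or_eq with h1 | h1
      · rw [← hpw]
        exact c.seam_mem_bSet_iff.2 h1
      · exfalso
        refine hw p.1 (Subtype.ext ?_)
        rw [capCollarB_collar, coe_collarPtB, ← hpw]
        congr 1
        refine Prod.ext rfl ?_
        show 1 - ((0 : I) : ℝ) = p.2
        rw [h1]
        norm_num
  · intro hw z hz
    have h := congrArg Subtype.val hz
    rw [capCollarB_collar, coe_collarPtB] at h
    rw [← h] at hw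
    have h' := c.seam_mem_bSet_iff.1 hw
    norm_num at h'

/-- The open strip of the collar of `W_B` below level `1` is `A ∩ B`. [folklore] -/
theorem capCollarB_strip_one : c.capCollarB.strip 1 = Subtype.val ⁻¹' (c.aSet ∩ c.bSet) := by
  rw [c.aSet_inter_bSet]
  ext w
  constructor
  · rintro ⟨q, ⟨h0, h1⟩, rfl⟩
    have h0' : (0 : ℝ) < q.2 := h0
    have h1' : (q.2 : ℝ) < 1 := h1
    exact ⟨(q.1, 1 - (q.2 : ℝ)), ⟨by show (0:ℝ) < 1 - q.2; linarith, by show 1 - (q.2:ℝ) < 1; linarith⟩,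
      rfl⟩
  · rintro ⟨p, ⟨h1, h2⟩, hpw⟩
    have hlev : (0 : ℝ) ≤ 1 - p.2 ∧ 1 - p.2 ≤ 1 := ⟨by linarith, by linarith⟩
    refine ⟨(p.1, ⟨1 - p.2, hlev⟩), ⟨?_, ?_⟩, ?_⟩
    · show (0 : ℝ) < 1 - p.2
      linarith
    · show 1 - p.2 < 1
      linarith
    · apply Subtype.ext
      rw [capCollarB_collar, coe_collarPtB, ← hpw]
      simp

/-! #### Homology of the pieces -/

/-- **`H_n(B; ℤ) ≅ H_n(𝔻²; ℤ)`**: `B ≅ interior(W_B) ≃ W_B ≃ core(W_B) = jD(𝔻²) ≅ 𝔻²`, the two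
homotopy equivalences being the collar pushes of `capCollarB` (Hatcher 2002, Prop. 3.42).
[cite: HatcherAT2002, Prop. 3.42] -/
def bSetHomologyIso (n : ℕ) : singularHomology ℤ ℤ ↥c.bSet n ≅ singularHomology ℤ ℤ (𝔻 2) n :=
  let κ := c.capCollarB
  let e₁ : ↥c.bSet ≃ₜ ↥κ.interior :=
    (preimageValHomeomorphOfSubset c.bSet_subset_wbSet).symm.trans
      (Homeomorph.setCongr c.capCollarB_interior.symm)
  let e₂ : ↥κ.interior ≃ₕ ↥c.wbSet := κ.interiorHomotopyEquiv (t := 1) zero_lt_one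
  let e₃ : ↥(κ.core 1) ≃ₕ ↥c.wbSet :=
    (κ.inclusionHomotopyEquiv 1 (κ.core 1) univ (subset_univ _)
      (fun _ _ _ hw => κ.push_mem_core_of_mem hw) (fun _ _ => mapsTo_univ _ _)
      (fun w _ => κ.push_mem_core 1 w)).trans (Homeomorph.Set.univ _).toHomotopyEquiv
  let e₄ : ↥(κ.core 1) ≃ₜ ↥(range c.jD) :=
    (Homeomorph.setCongr c.capCollarB_core_one).trans
      (preimageValHomeomorphOfSubset c.range_jD_subset_wbSet)
  let e₅ : (𝔻 2) ≃ₜ ↥(range c.jD) := c.isSmoothEmbedding_jD.isEmbedding.toHomeomorph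
  singularHomology.mapIso ℤ ℤ e₁ n ≪≫ singularHomology.isoOfHomotopyEquiv ℤ ℤ e₂ n ≪≫
    (singularHomology.isoOfHomotopyEquiv ℤ ℤ e₃ n).symm ≪≫ singularHomology.mapIso ℤ ℤ e₄ n ≪≫
      (singularHomology.mapIso ℤ ℤ e₅ n).symm

/-- **`H_n(B; ℤ) = 0` for `n ≠ 0`** (`B` has the homology of the contractible disc). [folklore] -/
theorem isZero_singularHomology_bSet {n : ℕ} (hn : n ≠ 0) : IsZero (singularHomology ℤ ℤ ↥c.bSet n) :=
  haveI : ContractibleSpace (𝔻 2) := Metric.contractibleSpace_closedBall zero_le_one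
  (isZero_singularHomology_of_contractibleSpace ℤ ℤ hn).of_iso (c.bSetHomologyIso n)

/-- **`H_n(A ∩ B; ℤ) ≅ H_n(𝕊¹; ℤ)`**: `A ∩ B` is the open strip `seam (∂S × (0, 1))` of the collar,
homotopy equivalent to a slice `∂S ≅ 𝕊¹` (`BoundaryCollar.stripHomotopyEquiv`). [folklore] -/
def abInterHomologyIso (n : ℕ) :
    singularHomology ℤ ℤ ↥(c.aSet ∩ c.bSet) n ≅ singularHomology ℤ ℤ (𝕊 1) n :=
  let κ := c.capCollarB
  let e₁ : ↥(c.aSet ∩ c.bSet) ≃ₜ ↥(κ.strip 1) :=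
    (preimageValHomeomorphOfSubset (inter_subset_right.trans c.bSet_subset_wbSet)).symm.trans
      (Homeomorph.setCongr c.capCollarB_strip_one.symm)
  let e₂ : ↥((𝓡∂ 2).boundary S) ≃ₕ ↥(κ.strip 1) :=
    κ.stripHomotopyEquiv levelHalf_pos levelHalf_lt_one
  let e₃ : ↥((𝓡∂ 2).boundary S) ≃ₜ ↥(𝕊 1) := c.φS.toHomeomorph
  singularHomology.mapIso ℤ ℤ e₁ n ≪≫ (singularHomology.isoOfHomotopyEquiv ℤ ℤ e₂ n).symm ≪≫
    singularHomology.mapIso ℤ ℤ e₃ n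

/-- `rank H₁(A ∩ B; ℤ) = 1` and `H₁(A ∩ B; ℤ)` is finitely generated (`H₁(𝕊¹) ≅ ℤ`, Hatcher
Cor. 2.14). [folklore] -/
theorem finrank_singularHomology_abInter_one :
    Module.finrank ℤ (singularHomology ℤ ℤ ↥(c.aSet ∩ c.bSet) 1) = 1 ∧
      Module.Finite ℤ (singularHomology ℤ ℤ ↥(c.aSet ∩ c.bSet) 1) := by
  obtain ⟨e⟩ := nonempty_singularHomology_sphere_iso_holds ℤ ℤ (n := 1) le_rfl
  exact finrank_eq_one_of_iso_ulift (c.abInterHomologyIso 1 ≪≫ e)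

/-! #### Mayer–Vietoris: the kernel of `H₁(A) → H₁(P)` is torsion -/

/-- **The kernel of `H₁(S ∖ ∂S) → H₁(S ∪_φ 𝔻²)` is torsion** (`S` compact connected orientable with
one boundary circle). Mayer–Vietoris for `P = A ∪ B` (Hatcher 2002, §2.2) reads
`0 = H₂(A) ⊕ H₂(B) → H₂(P) → H₁(A ∩ B) → H₁(A) ⊕ H₁(B) → H₁(P)`; here `H₂(P) ≅ ℤ` (the capped
surface is a closed connected `ℤ`-oriented surface, Hatcher Thm. 3.26) and `H₁(A ∩ B) ≅ ℤ`, so the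
image of `H₁(A ∩ B)` — the kernel of `H₁(A) ⊕ H₁(B) → H₁(P)` — has rank `0`, i.e. is torsion.
(For a non-orientable `S`, e.g. the Möbius band, `H₂(P) = 0` and the conclusion fails: the core
circle pushed to the boundary has class `2 ×` generator.) [cite: HatcherAT2002, §2.2 pp. 149–150] -/
theorem exists_smul_eq_zero_of_map_aSet_eq_zero [ConnectedSpace S] (μ : HomologicalOrientation ℤ c.P 2)
    {x : singularHomology ℤ ℤ ↥c.aSet 1}
    (hx : singularHomology.map ℤ ℤ (subsetIncl c.aSet) 1 x = 0) : ∃ n : ℤ, n ≠ 0 ∧ n • x = 0 := by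
  have hexc := relativeSingularHomology.isIso_map_of_interior_union_interior_holds ℤ ℤ c.P
  have hcov := c.interior_aSet_union_interior_bSet
  -- vanishing of `H₂(A)`, `H₂(B)`
  have hA2 := c.isZero_singularHomology_aSet_two
  have hB2 : IsZero (singularHomology ℤ ℤ ↥c.bSet 2) := c.isZero_singularHomology_bSet two_ne_zero
  -- `δ : H₂(P) → H₁(A ∩ B)` is injective
  have hψ2 : mayerVietoris.ψ ℤ ℤ c.aSet c.bSet 2 = 0 := by
    refine biprod.hom_ext' _ _ ?_ ?_
    · rw [comp_zero]
      exact hA2.eq_of_src _ _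
    · rw [comp_zero]
      exact hB2.eq_of_src _ _
  haveI : Mono (mayerVietoris.δ ℤ ℤ c.aSet c.bSet hexc hcov 1) :=
    (mayerVietoris.exact₂_holds ℤ ℤ c.aSet c.bSet hexc hcov 1).mono_g hψ2
  -- finiteness and ranks
  obtain ⟨hI1, hI1f⟩ := c.finrank_singularHomology_abInter_one
  haveI := hI1f
  haveI := c.connectedSpace_P
  have hP2 : Module.finrank ℤ (singularHomology ℤ ℤ c.P (1 + 1)) = 1 :=
    c.finrank_singularHomology_P_two μ
  -- the class `(x, 0)` lies in `ker ψ = im φ`, a torsion module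
  set ι : singularHomology ℤ ℤ ↥c.aSet 1 ⟶
      singularHomology ℤ ℤ ↥c.aSet 1 ⊞ singularHomology ℤ ℤ ↥c.bSet 1 := biprod.inl with hι
  have hmem : ι x ∈ LinearMap.range (mayerVietoris.φ ℤ ℤ c.aSet c.bSet 1).hom := by
    rw [(mayerVietoris.exact₁_holds ℤ ℤ c.aSet c.bSet hcov 1).moduleCat_range_eq_ker]
    show mayerVietoris.ψ ℤ ℤ c.aSet c.bSet 1 (ι x) = 0
    rw [hι, mayerVietoris.ψ, ← ModuleCat.comp_apply, biprod.inl_desc]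
    exact hx
  obtain ⟨n, hn, hnx⟩ := exists_smul_eq_zero_of_exact_of_finrank_eq
    (mayerVietoris.δ_comp_φ ℤ ℤ c.aSet c.bSet hexc hcov 1)
    (mayerVietoris.exact₃_holds ℤ ℤ c.aSet c.bSet hexc hcov 1) (hP2.trans hI1.symm) hmem
  refine ⟨n, hn, ?_⟩
  haveI : Mono ι := by rw [hι]; infer_instance
  have hinj : Function.Injective ι := (ModuleCat.mono_iff_injective ι).1 inferInstance
  apply hinj
  change ι.hom (n • x) = ι.hom 0
  rw [map_zsmul, map_zero]
  convert hnx using 1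
  exact (int_smul_eq_zsmul _ n _).symm

/-! #### Collar loops are torsion in `H₁(S ∖ ∂S; ℤ)` -/

omit [T2Space S] [CompactSpace S] in
/-- **The collar loop** at height `s > 0` over a loop `e` of the boundary circle: the loop
`t ↦ CS (e t, s)` in the interior `S ∖ ∂S` (the boundary circle pushed into the surface along the
collar). [folklore] -/
def collarLoop {z₀ : (𝓡∂ 2).boundary S} (e : Path z₀ z₀) {s : ℝ} (hs : 0 < s) :
    Path (c.collarPt' z₀ hs) (c.collarPt' z₀ hs) where
  toFun t := c.collarPt' (e t) hs
  continuous_toFun := by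
    rw [InteriorManifold.continuous_iff_comp_val]
    exact c.CS.continuousOn_toFun.comp_continuous (e.continuous.prodMk continuous_const)
      fun t => ⟨mem_univ _, hs.le⟩
  source' := by rw [e.source]
  target' := by rw [e.target]

omit [Nonempty ((𝓡∂ 2).boundary S)] [T2Space S] [CompactSpace S] in
/-- The value of the collar loop. [folklore] -/
@[simp] theorem collarLoop_apply {z₀ : (𝓡∂ 2).boundary S} (e : Path z₀ z₀) {s : ℝ} (hs : 0 < s)
    (t : I) : c.collarLoop e hs t = c.collarPt' (e t) hs := rfl

omit [Nonempty ((𝓡∂ 2).boundary S)] [T2Space S] [CompactSpace S] in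
/-- The underlying point of `S` of the collar loop. [folklore] -/
theorem collarLoop_apply_val {z₀ : (𝓡∂ 2).boundary S} (e : Path z₀ z₀) {s : ℝ} (hs : 0 < s)
    (t : I) : (c.collarLoop e hs t).val = c.CS.toFun (e t) s := rfl

/-- The seam loop `t ↦ seam (e t, s)` in the big open disc `B`, for `s < 1`. [folklore] -/
def seamLoopB {z₀ : (𝓡∂ 2).boundary S} (e : Path z₀ z₀) {s : ℝ} (hs1 : s < 1) :
    Path (⟨c.seam (z₀, s), c.seam_mem_bSet_iff.2 hs1⟩ : ↥c.bSet)
      ⟨c.seam (z₀, s), c.seam_mem_bSet_iff.2 hs1⟩ where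
  toFun t := ⟨c.seam (e t, s), c.seam_mem_bSet_iff.2 hs1⟩
  continuous_toFun := (c.continuous_seam.comp (e.continuous.prodMk continuous_const)).subtype_mk _
  source' := by simp only [e.source]
  target' := by simp only [e.target]

/-- **Collar loops are torsion in the homology of the open surface.** For a compact connected
orientable smooth surface `S` with one boundary circle (capping data `c`), every loop `e` of the
boundary circle pushed to a collar height `s ∈ (0, 1)` has a torsion Hurewicz class in
`H₁(S ∖ ∂S; ℤ)`: `n • h(collarLoop e s) = 0` for some `n ≠ 0`. Proof: in the capped surface
`P = S ∪_φ 𝔻²` the pushed loop lies in the big open disc `B`, which has trivial `H₁`, so its class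
dies in `H₁(P)`; and the kernel of `H₁(S ∖ ∂S) = H₁(A) → H₁(P)` is torsion
(`exists_smul_eq_zero_of_map_aSet_eq_zero`). (Classically: the boundary circle of a compact
orientable surface with connected boundary is null-homologous; only the torsion form is needed
downstream.) [folklore] -/
theorem exists_ne_zero_and_smul_loopClass_collarLoop_eq_zero [ConnectedSpace S]
    (ho : IsOrientable (𝓡∂ 2) S) {z₀ : (𝓡∂ 2).boundary S} (e : Path z₀ z₀) {s : ℝ} (hs : 0 < s)
    (hs1 : s < 1) :
    ∃ n : ℤ, n ≠ 0 ∧ n • loopClass ℤ ℤ (1 : ℤ) (c.collarLoop e hs) = 0 := by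
  haveI := c.connectedSpace_P
  obtain ⟨μ⟩ := isOrientableOver_int_of_isOrientable_holds (X := c.P) (n := 2) (c.isOrientable_P ho)
  -- the loop transported into `A ⊆ P`
  set LA : Path (c.aSetHomeomorph (c.collarPt' z₀ hs)) (c.aSetHomeomorph (c.collarPt' z₀ hs)) :=
    (c.collarLoop e hs).map c.aSetHomeomorph.continuous with hLA
  have hxA : loopClass ℤ ℤ (1 : ℤ) LA = singularHomology.map ℤ ℤ
      (c.aSetHomeomorph : C(InteriorManifold (𝓡∂ 2) S, ↥c.aSet)) 1
        (loopClass ℤ ℤ (1 : ℤ) (c.collarLoop e hs)) := by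
    rw [map_loopClass]
  -- its image in `P` is the seam loop, which also comes from `B`, where it is null-homologous
  have hP : singularHomology.map ℤ ℤ (subsetIncl c.aSet) 1 (loopClass ℤ ℤ (1 : ℤ) LA) = 0 := by
    have hB0 : loopClass ℤ ℤ (1 : ℤ) (c.seamLoopB e hs1) = 0 := by
      haveI := ModuleCat.subsingleton_of_isZero (c.isZero_singularHomology_bSet one_ne_zero)
      exact Subsingleton.elim _ _
    have h1 : loopClass ℤ ℤ (1 : ℤ) (LA.map (subsetIncl c.aSet).continuous) =
        loopClass ℤ ℤ (1 : ℤ) ((c.seamLoopB e hs1).map (subsetIncl c.bSet).continuous) := by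
      refine loopClass_congr_fun fun t => ?_
      show (c.aSetHomeomorph (c.collarPt' (e t) hs) : c.P) = c.seam (e t, s)
      rw [c.coe_aSetHomeomorph, c.inl_inr_collarPt']
    rw [map_loopClass, h1, ← map_loopClass, hB0, map_zero]
  obtain ⟨n, hn, hnA⟩ := c.exists_smul_eq_zero_of_map_aSet_eq_zero μ hP
  refine ⟨n, hn, ?_⟩
  apply singularHomology_map_homeomorph_injective c.aSetHomeomorph 1
  rw [map_zsmul, map_zero, ← hxA]
  exact hnA

end CapData

end Cap

/-! ### The Seifert longitude is null-homologous; Seifert tubes have framing zero -/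

section Knot

open Knot

/-- **A collar loop of a spanning surface is null-homologous in the knot complement.** Let `S` be
a compact connected orientable smooth surface with one boundary circle (capping data `c`) and
`G : S ∖ ∂S → S³ ∖ K` any continuous map of its interior into the complement of a knot `K` (for
a Seifert surface `F : S ↪ S³` of `K`, `G = F|_{S ∖ ∂S}`). Then every collar loop of `S` is
null-homologous in `S³ ∖ K`: its Hurewicz class is torsion in `H₁(S ∖ ∂S; ℤ)`
(`CapData.exists_ne_zero_and_smul_loopClass_collarLoop_eq_zero`), hence torsion in
`H₁(S³ ∖ K; ℤ) ≅ ℤ` (generated by the meridian, Alexander duality; Crowell–Fox VIII (1.2)), hence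
zero. This is the homological content of Gabai's Definition 8.1 of the longitude
(`0 = [λ] ∈ H₁(N - N̊(k))`) for the push-off of `k` into a Seifert surface, and Step 5 of the proof
of Cromwell's Thm. 5.8.1 ("the loops are preferred longitudes": a loop on `∂V` bounding a surface
outside `V` does not link the core). [cite: GabaiJDG1987, Def. 8.1]
[cite: Cromwell2004, §4.2 (preferred longitude) and Thm. 5.8.1, proof, Step 5] -/
theorem Knot.loopClass_collarLoop_map_eq_zero (K : Knot) {S : Type} [TopologicalSpace S]
    [T2Space S] [CompactSpace S] [ConnectedSpace S] [ChartedSpace (EuclideanHalfSpace 2) S]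
    [IsManifold (𝓡∂ 2) ∞ S] [Nonempty ((𝓡∂ 2).boundary S)] (c : CapData S)
    (ho : IsOrientable (𝓡∂ 2) S) (G : C(InteriorManifold (𝓡∂ 2) S, K.complement))
    {z₀ : (𝓡∂ 2).boundary S} (e : Path z₀ z₀) {s : ℝ} (hs : 0 < s) (hs1 : s < 1) :
    loopClass ℤ ℤ (1 : ℤ) ((c.collarLoop e hs).map G.continuous) = 0 := by
  obtain ⟨n, hn, hnS⟩ := c.exists_ne_zero_and_smul_loopClass_collarLoop_eq_zero ho e hs hs1
  obtain ⟨ν⟩ := Knot.nonempty_tubularNbhd_holds K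
  obtain ⟨k, hk⟩ := ν.exists_eq_zsmul_loopClass_meridian
    (loopClass ℤ ℤ (1 : ℤ) ((c.collarLoop e hs).map G.continuous))
  have h0 : (n * k) • loopClass ℤ ℤ (1 : ℤ) ν.meridian = 0 := by
    rw [mul_smul, ← hk, ← map_loopClass, ← map_zsmul, hnS, map_zero]
  have hnk : n * k = 0 := ν.zsmul_loopClass_meridian_injective (h0.trans (zero_smul ℤ _).symm)
  rw [hk, (mul_eq_zero.1 hnk).resolve_left hn, zero_smul]

namespace Knot.TubularNbhd

variable {K : Knot} (ν : Knot.TubularNbhd K)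

/-- **A tube whose longitude is null-homologous has framing `0`.** If the Hurewicz class of the
longitude (push-off) of the oriented tubular neighbourhood `ν` vanishes in `H₁(S³ ∖ K; ℤ)`, then
`ν.HasFraming 0`: writing `m` for the framing of `ν` (`exists_hasFraming`), `h(ℓ) = m • h(μ)`
(`loopClass_longitude_eq_of_hasFraming`) and `h(μ)` has infinite order
(`zsmul_loopClass_meridian_injective`), so `m = 0`. This is Cromwell's "preferred longitude"
(framing zero = linking number zero with the core) read homologically. [cite: Cromwell2004, §4.2]
[cite: Rolfsen1976, §5.D] -/
theorem hasFraming_zero_of_loopClass_longitude_eq_zero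
    (h : loopClass ℤ ℤ (1 : ℤ) ν.longitude = 0) : ν.HasFraming 0 := by
  obtain ⟨m, hm⟩ := ν.exists_hasFraming
  have h1 : m • loopClass ℤ ℤ (1 : ℤ) ν.meridian = 0 :=
    (ν.loopClass_longitude_eq_of_hasFraming hm).symm.trans h
  have hm0 : m = 0 := ν.zsmul_loopClass_meridian_injective (h1.trans (zero_smul ℤ _).symm)
  rwa [hm0] at hm

/-- **Seifert tubes have framing zero** (the *Seifert framing* is the `0`-framing; Juhász 2023,
Remark 4.12; Cromwell 2004, Thm. 5.8.1 Step 5; Gabai 1987, Def. 8.1). If the longitude of the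
oriented tubular neighbourhood `ν` of `K` is, pointwise, a collar loop of a compact connected
orientable surface with one boundary circle mapped continuously into `S³ ∖ K` by its interior —
as happens when `ν` is adapted to a Seifert surface `F` of `K`, the half-plane `ν (·, (t, 0))`,
`t ≥ 0`, being a collar of `∂S` in `F(S)` — then `ν.HasFraming 0`.
[cite: Juhasz2023, Remark 4.12] [cite: GabaiJDG1987, Def. 8.1] -/
theorem hasFraming_zero_of_longitude_eq_collarLoop {S : Type} [TopologicalSpace S]
    [T2Space S] [CompactSpace S] [ConnectedSpace S] [ChartedSpace (EuclideanHalfSpace 2) S]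
    [IsManifold (𝓡∂ 2) ∞ S] [Nonempty ((𝓡∂ 2).boundary S)] (c : CapData S)
    (ho : IsOrientable (𝓡∂ 2) S) (G : C(InteriorManifold (𝓡∂ 2) S, K.complement))
    {z₀ : (𝓡∂ 2).boundary S} (e : Path z₀ z₀) {s : ℝ} (hs : 0 < s) (hs1 : s < 1)
    (hℓ : ∀ t, ν.longitude t = G (c.collarLoop e hs t)) : ν.HasFraming 0 := by
  apply ν.hasFraming_zero_of_loopClass_longitude_eq_zero
  rw [loopClass_congr_fun (γ' := (c.collarLoop e hs).map G.continuous) hℓ]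
  exact K.loopClass_collarLoop_map_eq_zero c ho G e hs hs1

end Knot.TubularNbhd

/-! ### Seifert surfaces proper: the interior of a spanning surface lies in the complement -/

namespace Knot

/-- A Seifert surface lands in the `3`-sphere: `F x ∈ 𝕊³` when `‖F x‖ = 1`. [folklore] -/
theorem seifert_apply_mem_sphere {S : Type*} {F : S → 𝔼 4} (hF1 : ∀ x, ‖F x‖ = 1) (x : S) :
    F x ∈ 𝕊 3 := by
  rw [mem_sphere_zero_iff_norm]
  exact hF1 x

variable {K : Knot} {S : Type} [TopologicalSpace S] [ChartedSpace (EuclideanHalfSpace 2) S]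
  [IsManifold (𝓡∂ 2) ∞ S]

/-- **The interior of a Seifert surface misses the knot.** For a spanning surface
`F : S ↪ 𝕊³ ⊆ ℝ⁴` of `K` (`Knot.IsSpanningSurfaceOfGenus`: `F` injective with `F = K ∘ e` on
`∂S`, `e : ∂S ≃ₜ 𝕊¹`), an interior point of `S` is not mapped onto the knot: if `F y = K w` then
`w = e z` and `F y = F z` for the boundary point `z = e⁻¹ w`, so `y = z ∈ ∂S`. [folklore] -/
theorem IsSpanningSurfaceOfGenus.apply_interior_notMem_range {F : S → 𝔼 4}
    {e : ↥((𝓡∂ 2).boundary S) ≃ₜ ↥(𝕊 1)} {g : ℕ} (hF : K.IsSpanningSurfaceOfGenus F e g)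
    (hF1 : ∀ x, ‖F x‖ = 1) (y : InteriorManifold (𝓡∂ 2) S) :
    (⟨F y.val, seifert_apply_mem_sphere hF1 y.val⟩ : 𝕊 3) ∉ range K := by
  rintro ⟨w, hw⟩
  obtain ⟨_, _, hinj, _, hbd, _⟩ := hF
  have h1 : F y.val = F (e.symm w : ↥((𝓡∂ 2).boundary S)) := by
    rw [hbd (e.symm w), Homeomorph.apply_symm_apply]
    exact (congrArg Subtype.val hw).symm
  have h2 : y.val = (e.symm w : ↥((𝓡∂ 2).boundary S)) := hinj h1
  exact y.val_notMem_boundary (h2 ▸ (e.symm w).property)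

/-- **The interior of a Seifert surface, as a continuous map into the knot complement**
`S ∖ ∂S → S³ ∖ K`. [folklore] -/
def IsSpanningSurfaceOfGenus.interiorMap {F : S → 𝔼 4} {e : ↥((𝓡∂ 2).boundary S) ≃ₜ ↥(𝕊 1)}
    {g : ℕ} (hF : K.IsSpanningSurfaceOfGenus F e g) (hF1 : ∀ x, ‖F x‖ = 1) :
    C(InteriorManifold (𝓡∂ 2) S, K.complement) where
  toFun y := ⟨⟨F y.val, seifert_apply_mem_sphere hF1 y.val⟩, hF.apply_interior_notMem_range hF1 y⟩
  continuous_toFun := by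
    refine Continuous.subtype_mk (Continuous.subtype_mk ?_ _) _
    exact hF.2.1.continuous.comp InteriorManifold.continuous_val

/-- The value of `interiorMap` in `ℝ⁴` is `F`. [folklore] -/
@[simp] theorem IsSpanningSurfaceOfGenus.coe_coe_interiorMap {F : S → 𝔼 4}
    {e : ↥((𝓡∂ 2).boundary S) ≃ₜ ↥(𝕊 1)} {g : ℕ} (hF : K.IsSpanningSurfaceOfGenus F e g)
    (hF1 : ∀ x, ‖F x‖ = 1) (y : InteriorManifold (𝓡∂ 2) S) :
    (((hF.interiorMap hF1 y : K.complement) : 𝕊 3) : 𝔼 4) = F y.val := rfl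

/-- **The Seifert longitude is null-homologous** (Seifert-surface form of
`Knot.loopClass_collarLoop_map_eq_zero`): for a Seifert surface `F : S ↪ 𝕊³` of genus `g` of the
knot `K` (`S` compact connected, `K.IsSpanningSurfaceOfGenus F e g`, `‖F‖ = 1`) with capping data
`c`, the `F`-image of every collar loop of height `s ∈ (0, 1)` has Hurewicz class `0` in
`H₁(S³ ∖ K; ℤ)` — Gabai's longitude condition `0 = [λ] ∈ H₁(N - N̊(k))` (Def. 8.1) for the curve
`S ∩ ∂N(k)`. [cite: GabaiJDG1987, Def. 8.1] [cite: Cromwell2004, Thm. 5.8.1, proof, Step 5] -/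
theorem IsSpanningSurfaceOfGenus.loopClass_collarLoop_eq_zero [T2Space S] [CompactSpace S]
    [ConnectedSpace S] [Nonempty ((𝓡∂ 2).boundary S)] {F : S → 𝔼 4}
    {e : ↥((𝓡∂ 2).boundary S) ≃ₜ ↥(𝕊 1)} {g : ℕ} (hF : K.IsSpanningSurfaceOfGenus F e g)
    (hF1 : ∀ x, ‖F x‖ = 1) (c : CapData S) {z₀ : (𝓡∂ 2).boundary S} (γ : Path z₀ z₀) {s : ℝ}
    (hs : 0 < s) (hs1 : s < 1) :
    loopClass ℤ ℤ (1 : ℤ) ((c.collarLoop γ hs).map (hF.interiorMap hF1).continuous) = 0 :=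
  K.loopClass_collarLoop_map_eq_zero c hF.1 (hF.interiorMap hF1) γ hs hs1

/-- **A tube adapted to a Seifert surface has framing `0`** (the Seifert framing is the zero
framing, Juhász 2023, Remark 4.12): if the longitude of the oriented tubular neighbourhood `ν` of
`K` runs, pointwise in `ℝ⁴`, along a collar loop of a Seifert surface `F` of `K`
(`ν.longitude t = F (CS (γ t, s))`, `0 < s < 1`), then `ν.HasFraming 0`.
[cite: Juhasz2023, Remark 4.12] [cite: GabaiJDG1987, Def. 8.1] -/
theorem IsSpanningSurfaceOfGenus.hasFraming_zero_of_longitude_eq [T2Space S] [CompactSpace S]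
    [ConnectedSpace S] [Nonempty ((𝓡∂ 2).boundary S)] {F : S → 𝔼 4}
    {e : ↥((𝓡∂ 2).boundary S) ≃ₜ ↥(𝕊 1)} {g : ℕ} (hF : K.IsSpanningSurfaceOfGenus F e g)
    (hF1 : ∀ x, ‖F x‖ = 1) (c : CapData S) (ν : Knot.TubularNbhd K) {z₀ : (𝓡∂ 2).boundary S}
    (γ : Path z₀ z₀) {s : ℝ} (hs : 0 < s) (hs1 : s < 1)
    (hℓ : ∀ t, ((ν.longitude t : 𝕊 3) : 𝔼 4) = F (c.CS.toFun (γ t) s)) : ν.HasFraming 0 :=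
  ν.hasFraming_zero_of_longitude_eq_collarLoop c hF.1 (hF.interiorMap hF1) γ hs hs1 fun t =>
    Subtype.ext (Subtype.ext (hℓ t))

end Knot

end Knot

end Literature.Topology.FourManifolds
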